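import Summits.Parity.GeneralizedHardyLittlewood.Theorems.GreenTaoLevelTwoMNTwoCauchySchwarz

/-!
# Route `GreenTaoLevelTwo`, crux `MNTwo` (stmt-Parity-21276), line `birth`, stub `stub_mnVertical`:
# the first Cauchy–Schwarz of Lemma 24 in difference coordinates (GT 2008b §10)

Block V4 / H3 (= AIF §10 Lemma 24 "Type II sum implies major arc", the step "Using Lemma (cz) to
eliminate the `b(l)b(m)` factors, we conclude `|∑ f(l,m)conj f(l,m')conj f(l',m)f(l',m')| ≳ L²M²`.
We write `l' = l₀ + l₁`, `m' = m₀ + m₁` to obtain `|∑_{l₁,m₁} ∑_{l₀,m₀} F(l₀,m₀;l₁,m₁)| ≳ L²M²`") of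
the `stub_mnVertical` census (B. Green, T. Tao, *Quadratic uniformity of the Möbius function*,
Ann. Inst. Fourier 58 (2008) = arXiv:math/0606087, §10).  Def-free, explicit, for `f : ℤ → ℤ → ℂ`
vanishing outside the box `[1,L] × [1,M]`:

* `sum_Icc_eq_sum_shift` — `∑_{l' ∈ [1,L]} g(l') = ∑_{l₁ ∈ [−L,L]} g(l + l₁)` for `g` vanishing
  off `[1,L]` and `l ∈ [1,L]`;
* `first_cs_differences` —
  `‖∑ b(l)b'(m)f(l,m)‖⁴ ≤ L²M² · Re ∑_{l₁∈[−L,L]} ∑_{m₁∈[−M,M]} ∑_{l∈[1,L]} ∑_{m∈[1,M]}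
     f(l,m) conj f(l,m+m₁) conj f(l+l₁,m) f(l+l₁,m+m₁)`.

References: [GreenTao2008QuadraticMobius] arXiv:math/0606087 §10 (proof of Lemma 24), App. A
Lemma 38.
-/

open Finset
open scoped ComplexConjugate

namespace Summit.Parity.GeneralizedHardyLittlewood.GreenTaoLevelTwoMNTwoTypeIIFirstCS

open Summit.Parity.GeneralizedHardyLittlewood.GreenTaoLevelTwoMNTwoCauchySchwarz
  (norm_pow_four_sum_sum_le)

/-- **Passing to difference coordinates**: for `g : ℤ → ℂ` vanishing outside `[1,L]` and
`l ∈ [1,L]`, `∑_{l' ∈ [1,L]} g(l') = ∑_{l₁ ∈ [−L,L]} g(l + l₁)`. [folklore] -/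
theorem sum_Icc_eq_sum_shift {L : ℕ} (g : ℤ → ℂ) (hg : ∀ l', l' ∉ Icc (1 : ℤ) L → g l' = 0)
    {l : ℤ} (hl : l ∈ Icc (1 : ℤ) L) :
    ∑ l' ∈ Icc (1 : ℤ) L, g l' = ∑ l₁ ∈ Icc (-(L : ℤ)) L, g (l + l₁) := by
  rw [Finset.mem_Icc] at hl
  -- reindex the right-hand side by `l' = l + l₁`
  have hinj : Set.InjOn (fun l₁ : ℤ => l + l₁) ↑(Icc (-(L : ℤ)) L) := fun x _ y _ h => by
    simpa using h
  rw [← Finset.sum_image (f := g) hinj]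
  apply Finset.sum_subset_zero_on_sdiff
  · intro l' hl'
    rw [Finset.mem_image]
    rw [Finset.mem_Icc] at hl'
    exact ⟨l' - l, by rw [Finset.mem_Icc]; constructor <;> omega, by ring⟩
  · intro l' hl'
    rw [Finset.mem_sdiff] at hl'
    exact hg l' hl'.2
  · intro _ _; rfl

/-- **The first Cauchy–Schwarz of Lemma 24 in difference coordinates.**  For `f : ℤ → ℤ → ℂ`
vanishing outside `[1,L] × [1,M]` and `1`-bounded `b, b'`,
`‖∑_{l∈[1,L]} ∑_{m∈[1,M]} b(l)b'(m)f(l,m)‖⁴ ≤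
  L²M² · Re ∑_{l₁∈[−L,L]} ∑_{m₁∈[−M,M]} ∑_{l∈[1,L]} ∑_{m∈[1,M]} f(l,m)conj f(l,m+m₁)conj f(l+l₁,m)f(l+l₁,m+m₁)`.
[cite: GreenTao2008QuadraticMobius, §10 (proof of Lemma 24) and App. A Lemma 38] -/
theorem first_cs_differences {L M : ℕ} (f : ℤ → ℤ → ℂ)
    (hf : ∀ l m, (l ∉ Icc (1 : ℤ) L ∨ m ∉ Icc (1 : ℤ) M) → f l m = 0)
    (b b' : ℤ → ℂ) (hb : ∀ l, ‖b l‖ ≤ 1) (hb' : ∀ m, ‖b' m‖ ≤ 1) :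
    ‖∑ l ∈ Icc (1 : ℤ) L, ∑ m ∈ Icc (1 : ℤ) M, b l * b' m * f l m‖ ^ 4 ≤
      (L : ℝ) ^ 2 * (M : ℝ) ^ 2 *
        (∑ l₁ ∈ Icc (-(L : ℤ)) L, ∑ m₁ ∈ Icc (-(M : ℤ)) M, ∑ l ∈ Icc (1 : ℤ) L,
          ∑ m ∈ Icc (1 : ℤ) M,
            f l m * conj (f l (m + m₁)) * conj (f (l + l₁) m) * f (l + l₁) (m + m₁)).re := by
  have h := norm_pow_four_sum_sum_le (Icc (1 : ℤ) L) (Icc (1 : ℤ) M) b b' (fun l _ => hb l)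
    (fun m _ => hb' m) f
  have hcardL : (#(Icc (1 : ℤ) L) : ℝ) = L := by
    rw [Int.card_Icc]; simp
  have hcardM : (#(Icc (1 : ℤ) M) : ℝ) = M := by
    rw [Int.card_Icc]; simp
  rw [hcardL, hcardM] at h
  refine h.trans (le_of_eq ?_)
  congr 2
  -- rewrite the fourfold sum in difference coordinates
  -- Step 1: for fixed `l`, reindex `l' = l + l₁`
  have step1 : ∀ l ∈ Icc (1 : ℤ) L,
      ∑ l' ∈ Icc (1 : ℤ) L, ∑ m ∈ Icc (1 : ℤ) M, ∑ m' ∈ Icc (1 : ℤ) M,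
          f l m * conj (f l m') * conj (f l' m) * f l' m' =
        ∑ l₁ ∈ Icc (-(L : ℤ)) L, ∑ m ∈ Icc (1 : ℤ) M, ∑ m' ∈ Icc (1 : ℤ) M,
          f l m * conj (f l m') * conj (f (l + l₁) m) * f (l + l₁) m' := by
    intro l hl
    refine sum_Icc_eq_sum_shift (L := L)
      (fun l' => ∑ m ∈ Icc (1 : ℤ) M, ∑ m' ∈ Icc (1 : ℤ) M,
        f l m * conj (f l m') * conj (f l' m) * f l' m') (fun l' hl' => ?_) hl
    refine Finset.sum_eq_zero fun m _ => Finset.sum_eq_zero fun m' _ => ?_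
    rw [hf l' m (Or.inl hl'), map_zero, mul_zero, zero_mul]
  -- Step 2: for fixed `l, l₁, m`, reindex `m' = m + m₁`
  have step2 : ∀ (l l₁ : ℤ), ∀ m ∈ Icc (1 : ℤ) M,
      ∑ m' ∈ Icc (1 : ℤ) M, f l m * conj (f l m') * conj (f (l + l₁) m) * f (l + l₁) m' =
        ∑ m₁ ∈ Icc (-(M : ℤ)) M,
          f l m * conj (f l (m + m₁)) * conj (f (l + l₁) m) * f (l + l₁) (m + m₁) := by
    intro l l₁ m hm
    refine sum_Icc_eq_sum_shift (L := M)
      (fun m' => f l m * conj (f l m') * conj (f (l + l₁) m) * f (l + l₁) m')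
      (fun m' hm' => ?_) hm
    rw [hf l m' (Or.inr hm'), map_zero, mul_zero, zero_mul, zero_mul]
  calc ∑ l ∈ Icc (1 : ℤ) L, ∑ l' ∈ Icc (1 : ℤ) L, ∑ m ∈ Icc (1 : ℤ) M, ∑ m' ∈ Icc (1 : ℤ) M,
          f l m * conj (f l m') * conj (f l' m) * f l' m'
      = ∑ l ∈ Icc (1 : ℤ) L, ∑ l₁ ∈ Icc (-(L : ℤ)) L, ∑ m ∈ Icc (1 : ℤ) M, ∑ m' ∈ Icc (1 : ℤ) M,
          f l m * conj (f l m') * conj (f (l + l₁) m) * f (l + l₁) m' :=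
        Finset.sum_congr rfl fun l hl => step1 l hl
    _ = ∑ l ∈ Icc (1 : ℤ) L, ∑ l₁ ∈ Icc (-(L : ℤ)) L, ∑ m ∈ Icc (1 : ℤ) M,
          ∑ m₁ ∈ Icc (-(M : ℤ)) M,
            f l m * conj (f l (m + m₁)) * conj (f (l + l₁) m) * f (l + l₁) (m + m₁) :=
        Finset.sum_congr rfl fun l _ => Finset.sum_congr rfl fun l₁ _ =>
          Finset.sum_congr rfl fun m hm => step2 l l₁ m hm
    _ = ∑ l₁ ∈ Icc (-(L : ℤ)) L, ∑ l ∈ Icc (1 : ℤ) L, ∑ m ∈ Icc (1 : ℤ) M,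
          ∑ m₁ ∈ Icc (-(M : ℤ)) M,
            f l m * conj (f l (m + m₁)) * conj (f (l + l₁) m) * f (l + l₁) (m + m₁) :=
        Finset.sum_comm
    _ = _ := by
        refine Finset.sum_congr rfl fun l₁ _ => ?_
        rw [Finset.sum_congr rfl fun l _ => Finset.sum_comm]
        exact Finset.sum_comm

end Summit.Parity.GeneralizedHardyLittlewood.GreenTaoLevelTwoMNTwoTypeIIFirstCS
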